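import Mathlib
import Summits.Ventures.PercRepro2.Defs
import Summits.Ventures.PercRepro2.Graph
import Summits.Ventures.PercRepro2.Harris
import Summits.Ventures.PercRepro2.Events
import Summits.Ventures.PercRepro2.Independence
import Summits.Ventures.PercRepro2.Induced
import Summits.Ventures.PercRepro2.BHK
import Summits.Ventures.PercRepro2.VdBKahn
import Summits.Ventures.PercRepro2.BHKAvoid
import Summits.Ventures.PercRepro2.RowC1PendZCells

/-!
# Instance (I10) of the certificate of `zpp ≥ 0`: BHK at the root `o` (blind cell PercRepro2, p2 g36)

`bhk_induced` (BHK06 Thm 1.2, `U = univ`) at `s = o` with `F₁ = 1[a₂ ∈ C(o)]`, `F₂ = 1[a₂ ∈ C(o) ∨ b ∈ C(o)]`,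
`X = {v, b}`, `Y = {v}`:

  `P(a₂ ∈ C(o), o ↮ v, o ↮ b) · P({a₂, b} ∩ C(o) ≠ ∅, o ↮ v) ≤ P(a₂ ∈ C(o), o ↮ v) · P(o ↮ v, o ↮ b)`,

written on the fifteen pattern cells exactly as `zpp_cert_alg` / `zpp_nonneg_of_bhk` want it (`inst10_cells`;
proofs/P2-G36-CERT-ZPP.md, P2-G36-SYM.md §7).  Std axioms.
-/

namespace Summit.Ventures.PercRepro2

namespace RowC1

section Inst10

variable {V : Type*} {E : Type*} [Fintype E] [DecidableEq E] [Fintype V] [DecidableEq V]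
  {R : Type*} [Field R] [LinearOrder R] [IsStrictOrderedRing R]

omit [Fintype E] [DecidableEq E] [Fintype V] [DecidableEq V] [LinearOrder R] [IsStrictOrderedRing R] in
/-- orientation of a connection. -/
lemma conn_swap_10 (ends : E → Sym2 V) (ω : Config E) (x y : V) :
    Conn ends ω x y ↔ Conn ends ω y x := ⟨conn_symm, conn_symm⟩

omit [DecidableEq V] [LinearOrder R] [IsStrictOrderedRing R] in
/-- `E[1_𝓔(C_x) · 1_A] = P(C_x ∈ 𝓔, A)` with the cluster observable of the whole graph. -/
lemma expect_obs_indicator_10 (p : E → R) (ends : E → Sym2 V) (x : V) (𝓔 : Set (Set V))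
    (A : Set (Config E)) :
    expect p (clusterObs ends Finset.univ x (𝓔.indicator 1) * A.indicator 1) =
      prob p (clusterInEvent ends x 𝓔 ∩ A) := by
  rw [prob_eq_expect_indicator]
  unfold expect
  refine Finset.sum_congr rfl fun ω _ => ?_
  congr 1
  rw [indicator_inter_one]
  simp only [Pi.mul_apply, clusterObs, clusterIn, Finset.coe_univ, induced_univ]
  rfl

omit [DecidableEq V] [LinearOrder R] [IsStrictOrderedRing R] in
/-- the same for a product of two indicators. -/
lemma expect_obs_indicator_mul_10 (p : E → R) (ends : E → Sym2 V) (x : V) (𝓔 𝓕 : Set (Set V))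
    (A : Set (Config E)) :
    expect p (clusterObs ends Finset.univ x (𝓔.indicator 1 * 𝓕.indicator 1) * A.indicator 1) =
      prob p (clusterInEvent ends x (𝓔 ∩ 𝓕) ∩ A) := by
  rw [← Set.inter_indicator_one]
  exact expect_obs_indicator_10 p ends x (𝓔 ∩ 𝓕) A

omit [Fintype V] [LinearOrder R] [IsStrictOrderedRing R] in
/-- cell expansion of the event `E1` (instance I10). -/
theorem cs10_E1 (p : E → R) (ends : E → Sym2 V) (v a₂ o b : V) :
    prob p (clusterInEvent ends o {W : Set V | a₂ ∈ W} ∩ avoidAll ends o {v, b}) = (prob p (cell ends v a₂ o b 18) + prob p (cell ends v a₂ o b 2)) := by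
  have e : (clusterInEvent ends o {W : Set V | a₂ ∈ W} ∩ avoidAll ends o {v, b}) = {ω | (Nat.testBit (pattern ends v a₂ o b ω).val 1 = true ∧ ((¬ Nat.testBit (pattern ends v a₂ o b ω).val 3 = true) ∧ (¬ Nat.testBit (pattern ends v a₂ o b ω).val 5 = true)))} := by
    ext ω
    simp only [Set.mem_inter_iff, mem_clusterInEvent, Set.mem_setOf_eq, mem_cluster, mem_avoidAll, Finset.mem_insert, Finset.mem_singleton, forall_eq_or_imp, forall_eq, conn_swap_10 ends ω o a₂, conn_swap_10 ends ω o v, testBit_pattern_one, testBit_pattern_three, testBit_pattern_five]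
  rw [e, prob_pattern_eq_sum_trans p ends v a₂ o b (fun n => (Nat.testBit n.val 1 = true ∧ ((¬ Nat.testBit n.val 3 = true) ∧ (¬ Nat.testBit n.val 5 = true))))]
  rw [show (Finset.univ.filter (fun n : Fin 64 => IsTrans6 n ∧ (Nat.testBit n.val 1 = true ∧ ((¬ Nat.testBit n.val 3 = true) ∧ (¬ Nat.testBit n.val 5 = true))))) = ({18, 2} : Finset (Fin 64)) by decide]
  simp +decide only [Finset.sum_insert, Finset.mem_singleton, Finset.sum_singleton]
omit [Fintype V] [DecidableEq V] [LinearOrder R] [IsStrictOrderedRing R] in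
/-- cell expansion of the event `E2` (instance I10). -/
theorem cs10_E2 (p : E → R) (ends : E → Sym2 V) (v a₂ o b : V) :
    prob p (clusterInEvent ends o {W : Set V | a₂ ∈ W ∨ b ∈ W} ∩ avoidAll ends o {v}) = (prob p (cell ends v a₂ o b 33) + prob p (cell ends v a₂ o b 38) + prob p (cell ends v a₂ o b 18) + prob p (cell ends v a₂ o b 2) + prob p (cell ends v a₂ o b 32)) := by
  have e : (clusterInEvent ends o {W : Set V | a₂ ∈ W ∨ b ∈ W} ∩ avoidAll ends o {v}) = {ω | ((Nat.testBit (pattern ends v a₂ o b ω).val 1 = true ∨ Nat.testBit (pattern ends v a₂ o b ω).val 5 = true) ∧ (¬ Nat.testBit (pattern ends v a₂ o b ω).val 3 = true))} := by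
    ext ω
    simp only [Set.mem_inter_iff, mem_clusterInEvent, Set.mem_setOf_eq, mem_cluster, mem_avoidAll, Finset.mem_singleton, forall_eq, conn_swap_10 ends ω o a₂, conn_swap_10 ends ω o v, testBit_pattern_one, testBit_pattern_three, testBit_pattern_five]
  rw [e, prob_pattern_eq_sum_trans p ends v a₂ o b (fun n => ((Nat.testBit n.val 1 = true ∨ Nat.testBit n.val 5 = true) ∧ (¬ Nat.testBit n.val 3 = true)))]
  rw [show (Finset.univ.filter (fun n : Fin 64 => IsTrans6 n ∧ ((Nat.testBit n.val 1 = true ∨ Nat.testBit n.val 5 = true) ∧ (¬ Nat.testBit n.val 3 = true)))) = ({33, 38, 18, 2, 32} : Finset (Fin 64)) by decide]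
  simp +decide only [Finset.sum_insert, Finset.mem_insert, Finset.mem_singleton, Finset.sum_singleton]
  ring
omit [Fintype V] [DecidableEq V] [LinearOrder R] [IsStrictOrderedRing R] in
/-- cell expansion of the event `E3` (instance I10). -/
theorem cs10_E3 (p : E → R) (ends : E → Sym2 V) (v a₂ o b : V) :
    prob p (clusterInEvent ends o ({W : Set V | a₂ ∈ W} ∩ {W : Set V | a₂ ∈ W ∨ b ∈ W}) ∩ avoidAll ends o {v}) = (prob p (cell ends v a₂ o b 38) + prob p (cell ends v a₂ o b 18) + prob p (cell ends v a₂ o b 2)) := by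
  have e : (clusterInEvent ends o ({W : Set V | a₂ ∈ W} ∩ {W : Set V | a₂ ∈ W ∨ b ∈ W}) ∩ avoidAll ends o {v}) = {ω | ((Nat.testBit (pattern ends v a₂ o b ω).val 1 = true ∧ (Nat.testBit (pattern ends v a₂ o b ω).val 1 = true ∨ Nat.testBit (pattern ends v a₂ o b ω).val 5 = true)) ∧ (¬ Nat.testBit (pattern ends v a₂ o b ω).val 3 = true))} := by
    ext ω
    simp only [Set.mem_inter_iff, mem_clusterInEvent, Set.mem_setOf_eq, mem_cluster, mem_avoidAll, Finset.mem_singleton, forall_eq, conn_swap_10 ends ω o a₂, conn_swap_10 ends ω o v, testBit_pattern_one, testBit_pattern_three, testBit_pattern_five]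
  rw [e, prob_pattern_eq_sum_trans p ends v a₂ o b (fun n => ((Nat.testBit n.val 1 = true ∧ (Nat.testBit n.val 1 = true ∨ Nat.testBit n.val 5 = true)) ∧ (¬ Nat.testBit n.val 3 = true)))]
  rw [show (Finset.univ.filter (fun n : Fin 64 => IsTrans6 n ∧ ((Nat.testBit n.val 1 = true ∧ (Nat.testBit n.val 1 = true ∨ Nat.testBit n.val 5 = true)) ∧ (¬ Nat.testBit n.val 3 = true)))) = ({38, 18, 2} : Finset (Fin 64)) by decide]
  simp +decide only [Finset.sum_insert, Finset.mem_insert, Finset.mem_singleton, Finset.sum_singleton]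
  ring
omit [Fintype V] [LinearOrder R] [IsStrictOrderedRing R] in
/-- cell expansion of the event `E4` (instance I10). -/
theorem cs10_E4 (p : E → R) (ends : E → Sym2 V) (v a₂ o b : V) :
    prob p (avoidAll ends o {v, b}) = (prob p (cell ends v a₂ o b 21) + prob p (cell ends v a₂ o b 1) + prob p (cell ends v a₂ o b 18) + prob p (cell ends v a₂ o b 2) + prob p (cell ends v a₂ o b 4) + prob p (cell ends v a₂ o b 16) + prob p (cell ends v a₂ o b 0)) := by
  have e : (avoidAll ends o {v, b}) = {ω | ((¬ Nat.testBit (pattern ends v a₂ o b ω).val 3 = true) ∧ (¬ Nat.testBit (pattern ends v a₂ o b ω).val 5 = true))} := by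
    ext ω
    simp only [Set.mem_setOf_eq, mem_avoidAll, Finset.mem_insert, Finset.mem_singleton, forall_eq_or_imp, forall_eq, conn_swap_10 ends ω o v, testBit_pattern_three, testBit_pattern_five]
  rw [e, prob_pattern_eq_sum_trans p ends v a₂ o b (fun n => ((¬ Nat.testBit n.val 3 = true) ∧ (¬ Nat.testBit n.val 5 = true)))]
  rw [show (Finset.univ.filter (fun n : Fin 64 => IsTrans6 n ∧ ((¬ Nat.testBit n.val 3 = true) ∧ (¬ Nat.testBit n.val 5 = true)))) = ({21, 1, 18, 2, 4, 16, 0} : Finset (Fin 64)) by decide]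
  simp +decide only [Finset.sum_insert, Finset.mem_insert, Finset.mem_singleton, Finset.sum_singleton]
  ring

/-- **instance (I10)** on the cells (`bhk_induced` at the root `o`, `X = {v, b}`, `Y = {v}`). -/
theorem inst10_cells (p : E → R) (hp : IsProbVec p) (ends : E → Sym2 V) (v a₂ o b : V) :
    (prob p (cell ends v a₂ o b 18) + prob p (cell ends v a₂ o b 2)) * (prob p (cell ends v a₂ o b 33) + prob p (cell ends v a₂ o b 38) + prob p (cell ends v a₂ o b 18) + prob p (cell ends v a₂ o b 2) + prob p (cell ends v a₂ o b 32)) ≤ (prob p (cell ends v a₂ o b 38) + prob p (cell ends v a₂ o b 18) + prob p (cell ends v a₂ o b 2)) * (prob p (cell ends v a₂ o b 21) + prob p (cell ends v a₂ o b 1) + prob p (cell ends v a₂ o b 18) + prob p (cell ends v a₂ o b 2) + prob p (cell ends v a₂ o b 4) + prob p (cell ends v a₂ o b 16) + prob p (cell ends v a₂ o b 0)) := by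
  classical
  have H := bhk_induced p hp ends o (F₁ := ({W : Set V | a₂ ∈ W}).indicator 1)
    (F₂ := ({W : Set V | a₂ ∈ W ∨ b ∈ W}).indicator 1)
    (by
      intro W W' h
      have h' : W ⊆ W' := h
      simp only [Set.indicator, Set.mem_setOf_eq]
      split_ifs with h1 h2 <;> first | exact le_rfl | exact absurd (h' h1) h2 | norm_num)
    (by
      intro W W' h
      have h' : W ⊆ W' := h
      simp only [Set.indicator, Set.mem_setOf_eq]
      split_ifs with h1 h2 <;>
        first | exact le_rfl | exact absurd (Or.imp (fun x => h' x) (fun x => h' x) h1) h2 | norm_num)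
    (fun S => Set.indicator_nonneg (fun _ _ => zero_le_one) S)
    (fun S => Set.indicator_nonneg (fun _ _ => zero_le_one) S)
    Finset.univ {v, b} {v} (Finset.subset_univ _) (Finset.subset_univ _)
  have hXY : ({v, b} : Finset V) ∩ {v} = {v} := by
    ext x
    simp only [Finset.mem_inter, Finset.mem_insert, Finset.mem_singleton]
    tauto
  have hXUY : ({v, b} : Finset V) ∪ {v} = {v, b} := by
    ext x
    simp only [Finset.mem_union, Finset.mem_insert, Finset.mem_singleton]
    tauto
  rw [hXY, hXUY] at H
  simp only [REvent_univ] at H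
  rw [expect_obs_indicator_10 p ends o {W : Set V | a₂ ∈ W},
    expect_obs_indicator_10 p ends o {W : Set V | a₂ ∈ W ∨ b ∈ W},
    expect_obs_indicator_mul_10 p ends o {W : Set V | a₂ ∈ W} {W : Set V | a₂ ∈ W ∨ b ∈ W}] at H
  rw [cs10_E1 p ends v a₂ o b, cs10_E2 p ends v a₂ o b, cs10_E3 p ends v a₂ o b,
    cs10_E4 p ends v a₂ o b] at H
  linarith [H]

end Inst10

end RowC1

end Summit.Ventures.PercRepro2
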